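import Summits.KontsevichZagierPeriods.Zeta5Search.Barrier.ConeGammaFarSliceKminCert
import Summits.KontsevichZagierPeriods.Zeta5Search.Barrier.ConeGammaCritFarValue

/-!
# ζ(5) search — BARRIER: `C₀` TO FIRST ORDER IN THE FAR CHART — soundness III: concavity of the slice in `X`, the far
# point's `X`-range

HONEST FRAMING (cell `pub-zeta5`): systematic search; no irrationality claim unless kernel-certified. Theorems only. MODEL
objects under Brown–Zudilin's (28)+(30) ((28) observed, not proved): cert-2 g39's value function `Envelope.valueV` and its
`X`-log-form `gxF`, the checker's cells `cellRho` / `cellSum` / `concCell` / `concPiece` and `xRange` (`ConeGammaFarSliceCheck`),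
cert-2 g38's `xhatAF` (`ConeGammaCritFarValue.xhatAF_mem`). Nothing here is a statement about the size of any critical value of
record, any γ, the cone's supremum (C2 OPEN), S-E (CONJECTURED), (TD_A) or `ζ(5)`; no number of record moves; records in print
UNMOVED. Theory seat cert-2 g40 (item «C₀ TO FIRST ORDER IN THE FAR CHART — THE CENTRE-SLICE CERTIFICATE», part 3c).

* `cellRho_sound` — per form, on a cell (box × `X`-sub-piece × `Y`-range): `σ·tanD(L(a), L(b)) ≤ ρ·(β(b − a))²`
  (`FarSlice.tanD_le_of_pos` &c.; the two mixed forms `X + Y (+ s₆ − s₀)` by `Y`-ranges with unbounded ends);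
(The cell / piece / `Y`-range / `X`-range theorems are in `ConeGammaFarSliceConcPiece`.)
-/

open Finset Set
open Literature.Analysis.ValidatedNumerics.NumericsMP

namespace Summit.KontsevichZagierPeriods.Zeta5Search.Barrier.ConeGamma

namespace FarSlice

open Literature.Analysis.ValidatedNumerics (AForm)
open Literature.Analysis.ValidatedNumerics.AForm (Valid mem lo_le le_hi)
open LemmaFBox (SC SC_pos coef featVal minNum maxNum box centre minNum_le le_maxNum)
open Envelope (EForm formVal vforms valF gxF valueV mul_mem_minmax)
open CritBox (tAF coordAF boxOKc noise valid_noise tAF_mem coordAF_mem coordR linR)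
open CritFar (xNum xDen xhatAF xhatAF_mem)

/-! ### One form on a cell -/

/-- The `X`-range of a `Y`-free form on a cell: `A ≤ Q·M·L ≤ B`. -/
theorem formVal_cell_range {D T M : ℕ} {lo hi : List ℕ} {t : Fin 8 → ℝ} (ht : t ∈ box D lo hi)
    {xa xb : ℤ} {X : ℝ} (hX : (xa : ℝ) ≤ X * (2 * D * T * M) ∧ X * (2 * D * T * M) ≤ (xb : ℝ)) (f : EForm) (Y : ℝ)
    (hY : f.bY = 0) :
    ((2 * (T : ℤ) * M * minNum f.al lo hi + min (f.bx * xa) (f.bx * xb) : ℤ) : ℝ) ≤ formVal f t X Y * (2 * D * T * M) ∧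
      formVal f t X Y * (2 * D * T * M) ≤ ((2 * (T : ℤ) * M * maxNum f.al lo hi + max (f.bx * xa) (f.bx * xb) : ℤ) : ℝ) := by
  have h1 := minNum_le ht f.al
  have h2 := le_maxNum ht f.al
  have hx := mul_mem_minmax f.bx hX.1 hX.2
  have hTM : (0 : ℝ) ≤ 2 * T * M := by positivity
  have e : formVal f t X Y * (2 * D * T * M) = 2 * T * M * (featVal f.al t * D) + (f.bx : ℝ) * (X * (2 * D * T * M)) := by
    unfold formVal; rw [hY]; push_cast; ring
  push_cast
  rw [e]
  constructor <;> nlinarith [mul_le_mul_of_nonneg_left h1 hTM, mul_le_mul_of_nonneg_left h2 hTM, hx.1, hx.2]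

/-- **Soundness of the per-form curvature weight on a cell**: `σ·tanD(L(t; a, Y), L(t; b, Y)) ≤ ρ·(β·(b − a))²` for `t` in
the box, `a`, `b` in the `X`-sub-piece `[xa, xb]/(Q·M)` and `Y` within the optional bounds. -/
theorem cellRho_sound {D T M : ℕ} (hD : 0 < D) (hT : 0 < T) (hM : 0 < M) {lo hi : List ℕ} {xa xb : ℤ} {Ylo Yhi : OQ}
    {f : EForm} {ρ : ℚ} (h : cellRho D T M lo hi xa xb Ylo Yhi f = some ρ) {t : Fin 8 → ℝ} (ht : t ∈ box D lo hi)
    {Y : ℝ} (hYl : ∀ q : ℚ, Ylo = some q → (q : ℝ) ≤ Y) (hYu : ∀ q : ℚ, Yhi = some q → Y ≤ (q : ℝ)) {a b : ℝ}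
    (ha : (xa : ℝ) ≤ a * (2 * D * T * M) ∧ a * (2 * D * T * M) ≤ (xb : ℝ))
    (hb : (xa : ℝ) ≤ b * (2 * D * T * M) ∧ b * (2 * D * T * M) ≤ (xb : ℝ)) :
    (f.sg : ℝ) * tanD (formVal f t a Y) (formVal f t b Y) ≤ (ρ : ℝ) * ((f.bx : ℝ) * (b - a)) ^ 2 := by
  have hQM : (0 : ℝ) < 2 * D * T * M := by positivity
  have eΔ : formVal f t b Y - formVal f t a Y = (f.bx : ℝ) * (b - a) := by unfold formVal; ring
  unfold cellRho at h
  by_cases hbx : f.bx = 0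
  · rw [if_pos hbx] at h
    simp only [Option.some.injEq] at h
    subst h
    have : formVal f t b Y = formVal f t a Y := by have := eΔ; rw [hbx] at this; push_cast at this; linarith
    rw [this]
    simp [tanD]
  rw [if_neg hbx] at h
  by_cases hsg : ¬ (f.sg = 1 ∨ f.sg = -1)
  · rw [if_pos hsg] at h; simp at h
  rw [if_neg hsg] at h
  push Not at hsg
  set A0 := formVal f t a Y with hA0
  set B0 := formVal f t b Y with hB0
  rw [← eΔ]
  by_cases hY0 : f.bY = 0
  · rw [if_pos hY0] at h
    obtain ⟨ra1, ra2⟩ := formVal_cell_range (M := M) ht ha f Y hY0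
    obtain ⟨rb1, rb2⟩ := formVal_cell_range (M := M) ht hb f Y hY0
    rw [← hA0] at ra1 ra2; rw [← hB0] at rb1 rb2
    set A : ℤ := 2 * (T : ℤ) * M * minNum f.al lo hi + min (f.bx * xa) (f.bx * xb) with hAdef
    set B : ℤ := 2 * (T : ℤ) * M * maxNum f.al lo hi + max (f.bx * xa) (f.bx * xb) with hBdef
    by_cases hsd : 0 < A ∨ B < 0
    swap
    · rw [if_neg hsd] at h; simp at h
    rw [if_pos hsd] at h
    rcases hsd with hApos | hBneg
    · have hm : (0 : ℝ) < (A : ℝ) / (2 * D * T * M) := div_pos (by exact_mod_cast hApos) hQM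
      have la : (A : ℝ) / (2 * D * T * M) ≤ A0 := by rw [div_le_iff₀ hQM]; exact ra1
      have lb : (A : ℝ) / (2 * D * T * M) ≤ B0 := by rw [div_le_iff₀ hQM]; exact rb1
      rcases hsg with h1 | h1
      · rw [if_pos h1] at h
        simp only [Option.some.injEq] at h
        subst h
        rw [h1]; push_cast; rw [one_mul]
        calc tanD A0 B0 ≤ (B0 - A0) ^ 2 / (2 * ((A : ℝ) / (2 * D * T * M))) := tanD_le_of_pos hm la lb
          _ = 2 * (D : ℝ) * T * M / (2 * A) * (B0 - A0) ^ 2 := by field_simp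
      · rw [if_neg (by rw [h1]; norm_num)] at h
        simp only [Option.some.injEq] at h
        subst h
        have hA0p : 0 < A0 := lt_of_lt_of_le hm la
        have hB0p : 0 < B0 := lt_of_lt_of_le hm lb
        have hBpos : (0 : ℝ) < B := lt_of_lt_of_le (mul_pos hA0p hQM) ra2
        have ua : A0 ≤ (B : ℝ) / (2 * D * T * M) := by rw [le_div_iff₀ hQM]; exact ra2
        have ub : B0 ≤ (B : ℝ) / (2 * D * T * M) := by rw [le_div_iff₀ hQM]; exact rb2
        rw [h1]; push_cast
        calc (-1 : ℝ) * tanD A0 B0 = -tanD A0 B0 := by ring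
          _ ≤ -((B0 - A0) ^ 2 / (2 * ((B : ℝ) / (2 * D * T * M)))) := neg_tanD_le_of_pos hA0p hB0p ua ub
          _ = -(2 * (D : ℝ) * T * M) / (2 * B) * (B0 - A0) ^ 2 := by field_simp
    · have hA0n : A0 < 0 := by
        have : (B : ℝ) < 0 := by exact_mod_cast hBneg
        nlinarith
      have hB0n : B0 < 0 := by
        have : (B : ℝ) < 0 := by exact_mod_cast hBneg
        nlinarith
      have hAneg : (A : ℝ) < 0 := by nlinarith
      have hm : (0 : ℝ) < -(B : ℝ) / (2 * D * T * M) := div_pos (by exact_mod_cast (by linarith : 0 < -B)) hQM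
      rcases hsg with h1 | h1
      · rw [if_pos h1] at h
        simp only [Option.some.injEq] at h
        subst h
        have ua : -A0 ≤ -(A : ℝ) / (2 * D * T * M) := by rw [le_div_iff₀ hQM]; linarith
        have ub : -B0 ≤ -(A : ℝ) / (2 * D * T * M) := by rw [le_div_iff₀ hQM]; linarith
        rw [h1]; push_cast; rw [one_mul]
        calc tanD A0 B0 ≤ -((B0 - A0) ^ 2 / (2 * (-(A : ℝ) / (2 * D * T * M)))) := tanD_le_of_neg hA0n hB0n ua ub
          _ = 2 * (D : ℝ) * T * M / (2 * A) * (B0 - A0) ^ 2 := by field_simp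
      · rw [if_neg (by rw [h1]; norm_num)] at h
        simp only [Option.some.injEq] at h
        subst h
        have la : -(B : ℝ) / (2 * D * T * M) ≤ -A0 := by rw [div_le_iff₀ hQM]; linarith
        have lb : -(B : ℝ) / (2 * D * T * M) ≤ -B0 := by rw [div_le_iff₀ hQM]; linarith
        rw [h1]; push_cast
        calc (-1 : ℝ) * tanD A0 B0 = -tanD A0 B0 := by ring
          _ ≤ (B0 - A0) ^ 2 / (2 * (-(B : ℝ) / (2 * D * T * M))) := neg_tanD_le_of_neg hm la lb
          _ = -(2 * (D : ℝ) * T * M) / (2 * B) * (B0 - A0) ^ 2 := by field_simp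
  · -- the mixed forms: `L = α·t + X + Y`
    rw [if_neg hY0] at h
    by_cases hmix : ¬ (f.bx = 1 ∧ f.bY = 1)
    · rw [if_pos hmix] at h; simp at h
    rw [if_neg hmix] at h
    push Not at hmix
    obtain ⟨hbx1, hbY1⟩ := hmix
    -- the `X`-part range with `bY` set to `0`
    obtain ⟨ra1, ra2⟩ := formVal_cell_range (M := M) ht ha ⟨f.sg, f.al, 1, 0⟩ Y rfl
    obtain ⟨rb1, rb2⟩ := formVal_cell_range (M := M) ht hb ⟨f.sg, f.al, 1, 0⟩ Y rfl
    simp only [one_mul] at ra1 ra2 rb1 rb2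
    have eA : A0 = formVal ⟨f.sg, f.al, 1, 0⟩ t a Y + Y := by
      rw [hA0]; unfold formVal; rw [hbY1, hbx1]; push_cast; ring
    have eB : B0 = formVal ⟨f.sg, f.al, 1, 0⟩ t b Y + Y := by
      rw [hB0]; unfold formVal; rw [hbY1, hbx1]; push_cast; ring
    set Amin : ℚ := ((2 * (T : ℤ) * M * minNum f.al lo hi + min xa xb : ℤ) : ℚ) / (2 * (D : ℚ) * T * M) with hAmin
    set Bmax : ℚ := ((2 * (T : ℤ) * M * maxNum f.al lo hi + max xa xb : ℤ) : ℚ) / (2 * (D : ℚ) * T * M) with hBmax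
    have hAminR : ((Amin : ℚ) : ℝ) ≤ formVal ⟨f.sg, f.al, 1, 0⟩ t a Y ∧ ((Amin : ℚ) : ℝ) ≤ formVal ⟨f.sg, f.al, 1, 0⟩ t b Y := by
      rw [hAmin]; push_cast
      constructor <;> rw [div_le_iff₀ hQM]
      · exact_mod_cast ra1
      · exact_mod_cast rb1
    have hBmaxR : formVal ⟨f.sg, f.al, 1, 0⟩ t a Y ≤ ((Bmax : ℚ) : ℝ) ∧ formVal ⟨f.sg, f.al, 1, 0⟩ t b Y ≤ ((Bmax : ℚ) : ℝ) := by
      rw [hBmax]; push_cast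
      constructor <;> rw [le_div_iff₀ hQM]
      · exact_mod_cast ra2
      · exact_mod_cast rb2
    -- case analysis on the optional `Y`-bounds exactly as the checker
    rcases hYlo : Ylo with _ | l <;> rcases hYhi : Yhi with _ | u <;> simp only [hYlo, hYhi, Option.map] at h
    · simp at h
    · -- only an upper bound `u`: need `Bmax + u < 0`
      by_cases hu : Bmax + u < 0
      · rw [if_pos hu] at h
        have hYu' := hYu u hYhi
        have hA0n : A0 < 0 := by
          have : ((Bmax + u : ℚ) : ℝ) < 0 := by exact_mod_cast hu
          push_cast at this; rw [eA]; linarith [hBmaxR.1]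
        have hB0n : B0 < 0 := by
          have : ((Bmax + u : ℚ) : ℝ) < 0 := by exact_mod_cast hu
          push_cast at this; rw [eB]; linarith [hBmaxR.2]
        rcases hsg with h1 | h1
        · rw [if_pos h1] at h; simp only [Option.some.injEq] at h; subst h
          rw [h1]; push_cast; rw [one_mul, zero_mul]
          exact tanD_nonpos_of_neg hA0n hB0n
        · rw [if_neg (by rw [h1]; norm_num)] at h; simp only [Option.some.injEq] at h; subst h
          have la : -((Bmax + u : ℚ) : ℝ) ≤ -A0 := by push_cast; rw [eA]; linarith [hBmaxR.1]
          have lb : -((Bmax + u : ℚ) : ℝ) ≤ -B0 := by push_cast; rw [eB]; linarith [hBmaxR.2]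
          have hm : (0 : ℝ) < -((Bmax + u : ℚ) : ℝ) := by
            have h' : ((Bmax + u : ℚ) : ℝ) < 0 := by exact_mod_cast hu
            linarith
          rw [h1]; push_cast
          calc (-1 : ℝ) * tanD A0 B0 = -tanD A0 B0 := by ring
            _ ≤ (B0 - A0) ^ 2 / (2 * -((Bmax + u : ℚ) : ℝ)) := neg_tanD_le_of_neg hm la lb
            _ = -1 / (2 * ((Bmax : ℝ) + u)) * (B0 - A0) ^ 2 := by push_cast; field_simp
      · rw [if_neg hu] at h; simp at h
    · -- only a lower bound `l`: need `0 < Amin + l`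
      by_cases hl : 0 < Amin + l
      · rw [if_pos hl] at h
        have hYl' := hYl l hYlo
        have hm : (0 : ℝ) < ((Amin + l : ℚ) : ℝ) := by exact_mod_cast hl
        have la : ((Amin + l : ℚ) : ℝ) ≤ A0 := by push_cast; rw [eA]; linarith [hAminR.1]
        have lb : ((Amin + l : ℚ) : ℝ) ≤ B0 := by push_cast; rw [eB]; linarith [hAminR.2]
        rcases hsg with h1 | h1
        · rw [if_pos h1] at h; simp only [Option.some.injEq] at h; subst h
          rw [h1]; push_cast; rw [one_mul]
          calc tanD A0 B0 ≤ (B0 - A0) ^ 2 / (2 * ((Amin + l : ℚ) : ℝ)) := tanD_le_of_pos hm la lb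
            _ = 1 / (2 * ((Amin : ℝ) + l)) * (B0 - A0) ^ 2 := by push_cast; field_simp
        · rw [if_neg (by rw [h1]; norm_num)] at h; simp only [Option.some.injEq] at h; subst h
          rw [h1]; push_cast; rw [zero_mul]
          have := neg_tanD_nonpos_of_pos (lt_of_lt_of_le hm la) (lt_of_lt_of_le hm lb)
          linarith
      · rw [if_neg hl] at h; simp at h
    · -- both bounds
      have hYl' := hYl l hYlo
      have hYu' := hYu u hYhi
      by_cases hl : 0 < Amin + l
      · rw [if_pos hl] at h
        have hm : (0 : ℝ) < ((Amin + l : ℚ) : ℝ) := by exact_mod_cast hl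
        have la : ((Amin + l : ℚ) : ℝ) ≤ A0 := by push_cast; rw [eA]; linarith [hAminR.1]
        have lb : ((Amin + l : ℚ) : ℝ) ≤ B0 := by push_cast; rw [eB]; linarith [hAminR.2]
        have ua : A0 ≤ ((Bmax + u : ℚ) : ℝ) := by push_cast; rw [eA]; linarith [hBmaxR.1]
        have ub : B0 ≤ ((Bmax + u : ℚ) : ℝ) := by push_cast; rw [eB]; linarith [hBmaxR.2]
        rcases hsg with h1 | h1
        · rw [if_pos h1] at h; simp only [Option.some.injEq] at h; subst h
          rw [h1]; push_cast; rw [one_mul]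
          calc tanD A0 B0 ≤ (B0 - A0) ^ 2 / (2 * ((Amin + l : ℚ) : ℝ)) := tanD_le_of_pos hm la lb
            _ = 1 / (2 * ((Amin : ℝ) + l)) * (B0 - A0) ^ 2 := by push_cast; field_simp
        · rw [if_neg (by rw [h1]; norm_num)] at h; simp only [Option.some.injEq] at h; subst h
          have hA0p : 0 < A0 := lt_of_lt_of_le hm la
          have hB0p : 0 < B0 := lt_of_lt_of_le hm lb
          have hU : (0 : ℝ) < ((Bmax + u : ℚ) : ℝ) := lt_of_lt_of_le hA0p ua
          rw [h1]; push_cast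
          calc (-1 : ℝ) * tanD A0 B0 = -tanD A0 B0 := by ring
            _ ≤ -((B0 - A0) ^ 2 / (2 * ((Bmax + u : ℚ) : ℝ))) := neg_tanD_le_of_pos hA0p hB0p ua ub
            _ = -1 / (2 * ((Bmax : ℝ) + u)) * (B0 - A0) ^ 2 := by push_cast; field_simp
      · rw [if_neg hl] at h
        by_cases hu : Bmax + u < 0
        · rw [if_pos hu] at h
          have hA0n : A0 < 0 := by
            have : ((Bmax + u : ℚ) : ℝ) < 0 := by exact_mod_cast hu
            push_cast at this; rw [eA]; linarith [hBmaxR.1]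
          have hB0n : B0 < 0 := by
            have : ((Bmax + u : ℚ) : ℝ) < 0 := by exact_mod_cast hu
            push_cast at this; rw [eB]; linarith [hBmaxR.2]
          rcases hsg with h1 | h1
          · rw [if_pos h1] at h; simp only [Option.some.injEq] at h; subst h
            have hL : ((Amin + l : ℚ) : ℝ) < 0 := lt_of_le_of_lt (by push_cast; rw [eA] at hA0n; linarith [hAminR.1] : ((Amin + l : ℚ) : ℝ) ≤ A0) hA0n
            have ua : -A0 ≤ -((Amin + l : ℚ) : ℝ) := by push_cast; rw [eA]; linarith [hAminR.1]
            have ub : -B0 ≤ -((Amin + l : ℚ) : ℝ) := by push_cast; rw [eB]; linarith [hAminR.2]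
            rw [h1]; push_cast; rw [one_mul]
            calc tanD A0 B0 ≤ -((B0 - A0) ^ 2 / (2 * -((Amin + l : ℚ) : ℝ))) := tanD_le_of_neg hA0n hB0n ua ub
              _ = 1 / (2 * ((Amin : ℝ) + l)) * (B0 - A0) ^ 2 := by push_cast; field_simp
          · rw [if_neg (by rw [h1]; norm_num)] at h; simp only [Option.some.injEq] at h; subst h
            have la : -((Bmax + u : ℚ) : ℝ) ≤ -A0 := by push_cast; rw [eA]; linarith [hBmaxR.1]
            have lb : -((Bmax + u : ℚ) : ℝ) ≤ -B0 := by push_cast; rw [eB]; linarith [hBmaxR.2]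
            have hm : (0 : ℝ) < -((Bmax + u : ℚ) : ℝ) := by
              have h' : ((Bmax + u : ℚ) : ℝ) < 0 := by exact_mod_cast hu
              linarith
            rw [h1]; push_cast
            calc (-1 : ℝ) * tanD A0 B0 = -tanD A0 B0 := by ring
              _ ≤ (B0 - A0) ^ 2 / (2 * -((Bmax + u : ℚ) : ℝ)) := neg_tanD_le_of_neg hm la lb
              _ = -1 / (2 * ((Bmax : ℝ) + u)) * (B0 - A0) ^ 2 := by push_cast; field_simp
        · rw [if_neg hu] at h; simp at h

end FarSlice

end Summit.KontsevichZagierPeriods.Zeta5Search.Barrier.ConeGamma
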